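import Mathlib
import Summits.NavierStokesRegularity.NavierStokesRegularity.Theorems.WakeRatchetTailRatchetRelayProfile
import HarnessLib

/-!
# `WakeRatchet.TailRatchet` (stmt-NavierStokesRegularity-21808): the KERNEL of the linearised drain-free
# front equation at the relay profile is one-dimensional — uniqueness for the pantograph equation
# `h' = 2e^{t/2} h(t/2)` on `(−∞,0]`

Support file for the crux `TailRatchet` (route `WakeRatchet`; MODEL lattice ODEs of Tao 2016 §1.2, §4 —
nothing in this file is a statement about the Navier–Stokes equations, and no item is closed here).

Context (files `WakeRatchetTailRatchetRelayProfile` / `…RelayAdjoint` / `…RelayTransversality`; census of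
stmt-21808, programme "R-lac", step R-lac-1): the normalised scalar front equation of the construction
item `DyadicScalarFronts` at lacunarity `δ = Λ⁻² = 0` has the exact solution `(b₀,s₀) = (e^{t},2)` (relay
profile); its linearisation in `b` is the pantograph operator `L₀h = h' − 2e^{t/2}h(t/2)`, and the scaling
mode `h₁ = (1+t)e^{t}` lies in its kernel (`WakeRatchetRelayProfile.relay_kernel_hasDerivAt`).  Read from
`0⁻` towards `−∞` the advanced argument `t/2 ∈ (t,0)` is RETARDED, so the value `h(0)` should determine the
solution.  This file proves exactly that, sorry-free and with no growth or decay hypothesis at `−∞`: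

* `pantograph_eq_zero` — a function continuous on `(−∞,0]`, solving `h' = 2e^{t/2}h(t/2)` on `t < 0`, with
  `h(0) = 0`, vanishes identically on `(−∞,0]` (sup-bound `M ≤ M/2` on `[−¼,0]`, then dyadic continuation
  `[−τ,0] ↦ [−2τ,0]`, where the right-hand side already vanishes);
* `pantograph_kernel` — **every such solution is `h(0)·(1+t)e^{t}`**: the kernel of `L₀` on profiles
  continuous at `0⁻` is EXACTLY the span of the scaling mode.

Together with the adjoint mode `w₁` (co-kernel) and the transversality `∫w₁(1+t/2)e^{t} < 0` of the companion
files, this is the index bookkeeping of the bordered linearisation `(h,σ) ↦ L₀h + σ(1+t/2)e^{t}` that an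
implicit-function construction of scalar dyadic fronts for LACUNARY `Λ` needs (remaining: the solvability
theorem `range L₀ = ker(∫w₁·)` on weighted spaces and the `C¹` setting — census R-lac-2…4).  Fronts for
lacunary `Λ` do NOT refute `TailRatchet` (which needs `Λ → 1`).

HONEST FRAMING: elementary real analysis; MODEL lattice only; the construction item and the crux stay open.
-/

noncomputable section

set_option linter.dupNamespace false

namespace Summit.NavierStokesRegularity.NavierStokesRegularity.Theorems

namespace WakeRatchetRelayKernel

open Set Filter Topology Real
open WakeRatchetRelayProfile

/-! ## Step 1: vanishing near `0⁻` -/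

/-- **Smallness step.**  If `h` is continuous on `(−∞,0]`, solves `h' = 2e^{t/2}h(t/2)` on `t < 0` and
`h(0) = 0`, then `h ≡ 0` on `[−¼, 0]` (the supremum `M` of `|h|` there obeys `M ≤ M/2`). [folklore] -/
theorem pantograph_eq_zero_near {h : ℝ → ℝ} (hcont : ContinuousOn h (Iic 0))
    (hde : ∀ t : ℝ, t < 0 → HasDerivAt h (2 * Real.exp (t / 2) * h (t / 2)) t) (h0 : h 0 = 0) :
    ∀ t ∈ Icc (-(1 / 4 : ℝ)) 0, h t = 0 := by
  have hsub : Icc (-(1 / 4 : ℝ)) 0 ⊆ Iic 0 := Icc_subset_Iic_self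
  have hcont' : ContinuousOn (fun t => |h t|) (Icc (-(1 / 4 : ℝ)) 0) :=
    (continuous_abs.comp_continuousOn (hcont.mono hsub))
  obtain ⟨tm, htm, hmax⟩ := isCompact_Icc.exists_isMaxOn
    (nonempty_Icc.2 (by norm_num : (-(1 / 4 : ℝ)) ≤ 0)) hcont'
  rw [isMaxOn_iff] at hmax
  set M := |h tm| with hM_def
  have hM0 : 0 ≤ M := abs_nonneg _
  -- every value on the interval is at most `M/2`
  have key : ∀ t ∈ Icc (-(1 / 4 : ℝ)) 0, |h t| ≤ M / 2 := by
    intro t ht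
    rcases ht.2.eq_or_lt with rfl | htlt
    · rw [h0, abs_zero]; positivity
    -- mean value estimate on `[t, 0]` with the bound `|h'| ≤ 2M`
    have hc : ContinuousOn h (Icc t 0) := hcont.mono Icc_subset_Iic_self
    have hd : ∀ x ∈ Ico t 0, HasDerivWithinAt h (2 * Real.exp (x / 2) * h (x / 2)) (Ici x) x :=
      fun x hx => (hde x hx.2).hasDerivWithinAt
    have hb : ∀ x ∈ Ico t 0, ‖2 * Real.exp (x / 2) * h (x / 2)‖ ≤ 2 * M := by
      intro x hx
      have hx2 : x / 2 ∈ Icc (-(1 / 4 : ℝ)) 0 := ⟨by linarith [ht.1, hx.1], by linarith [hx.2]⟩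
      have he : Real.exp (x / 2) ≤ 1 := Real.exp_le_one_iff.2 (by linarith [hx.2])
      rw [Real.norm_eq_abs, abs_mul, abs_mul, abs_two, abs_of_pos (Real.exp_pos _)]
      calc 2 * Real.exp (x / 2) * |h (x / 2)| ≤ 2 * 1 * M :=
          mul_le_mul (mul_le_mul_of_nonneg_left he (by norm_num)) (hmax _ hx2) (abs_nonneg _)
            (by norm_num)
        _ = 2 * M := by ring
    have hmv := norm_image_sub_le_of_norm_deriv_right_le_segment hc hd hb 0
      ⟨htlt.le, le_rfl⟩
    rw [h0, zero_sub, norm_neg, Real.norm_eq_abs] at hmv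
    calc |h t| ≤ 2 * M * (0 - t) := hmv
      _ ≤ 2 * M * (1 / 4) := mul_le_mul_of_nonneg_left (by linarith [ht.1]) (by positivity)
      _ = M / 2 := by ring
  have hMle : M ≤ M / 2 := key tm htm
  have hM : M = 0 := le_antisymm (by linarith) hM0
  intro t ht
  have := key t ht
  rw [hM, zero_div] at this
  exact abs_eq_zero.1 (le_antisymm this (abs_nonneg _))

/-! ## Step 2: dyadic continuation towards `−∞` -/

/-- **Continuation step.**  If such a solution vanishes on `[−τ, 0]` (`τ ≥ 0`), it vanishes on `[−2τ, 0]`: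
on `[−2τ, −τ]` the right-hand side `2e^{t/2}h(t/2)` is already zero. [folklore] -/
theorem pantograph_eq_zero_double {h : ℝ → ℝ} (hcont : ContinuousOn h (Iic 0))
    (hde : ∀ t : ℝ, t < 0 → HasDerivAt h (2 * Real.exp (t / 2) * h (t / 2)) t) {τ : ℝ} (hτ : 0 ≤ τ)
    (hz : ∀ t ∈ Icc (-τ) 0, h t = 0) : ∀ t ∈ Icc (-(2 * τ)) 0, h t = 0 := by
  intro t ht
  by_cases hcase : -τ ≤ t
  · exact hz t ⟨hcase, ht.2⟩
  · rw [not_le] at hcase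
    have hτ0 : h (-τ) = 0 := hz (-τ) ⟨le_rfl, by linarith⟩
    have hc : ContinuousOn h (Icc t (-τ)) := hcont.mono (Icc_subset_Iic_iff hcase.le |>.2 (by linarith))
    have hd : ∀ x ∈ Ico t (-τ), HasDerivWithinAt h 0 (Ici x) x := by
      intro x hx
      have hx0 : x < 0 := by linarith [hx.2]
      have hx2 : h (x / 2) = 0 := hz (x / 2) ⟨by linarith [ht.1, hx.1], by linarith⟩
      have := (hde x hx0).hasDerivWithinAt (s := Ici x)
      rwa [hx2, mul_zero] at this
    have := constant_of_has_deriv_right_zero hc hd (-τ) ⟨hcase.le, le_rfl⟩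
    rw [hτ0] at this
    exact this.symm

/-- Vanishing on `[−2^n/4, 0]` for every `n`. [folklore] -/
theorem pantograph_eq_zero_pow {h : ℝ → ℝ} (hcont : ContinuousOn h (Iic 0))
    (hde : ∀ t : ℝ, t < 0 → HasDerivAt h (2 * Real.exp (t / 2) * h (t / 2)) t) (h0 : h 0 = 0) (n : ℕ) :
    ∀ t ∈ Icc (-((2 : ℝ) ^ n / 4)) 0, h t = 0 := by
  induction n with
  | zero =>
    simpa only [pow_zero] using pantograph_eq_zero_near hcont hde h0
  | succ n ih =>
    have h2 : (2 : ℝ) ^ (n + 1) / 4 = 2 * (2 ^ n / 4) := by rw [pow_succ]; ring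
    rw [h2]
    exact pantograph_eq_zero_double hcont hde (by positivity) ih

/-- **UNIQUENESS for the pantograph equation.**  A function continuous on `(−∞,0]`, solving
`h' = 2e^{t/2}h(t/2)` on `t < 0`, with `h(0) = 0`, vanishes on all of `(−∞,0]` — no growth or decay
hypothesis at `−∞` is needed.
[cite: Tao2016AveragedNS, §1.2 (dyadic model); cell vocabulary (linearisation of the scalar front equation of `DyadicScalarFronts` at the relay profile, drain dropped)] -/
theorem pantograph_eq_zero {h : ℝ → ℝ} (hcont : ContinuousOn h (Iic 0))
    (hde : ∀ t : ℝ, t < 0 → HasDerivAt h (2 * Real.exp (t / 2) * h (t / 2)) t) (h0 : h 0 = 0) :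
    ∀ t : ℝ, t ≤ 0 → h t = 0 := by
  intro t ht
  obtain ⟨n, hn⟩ := pow_unbounded_of_one_lt (4 * (-t)) (by norm_num : (1 : ℝ) < 2)
  exact pantograph_eq_zero_pow hcont hde h0 n t ⟨by linarith, ht⟩

/-! ## The kernel is the span of the scaling mode -/

/-- **THE KERNEL OF `L₀` IS ONE-DIMENSIONAL.**  Every function continuous on `(−∞,0]` solving the
linearised drain-free front equation `h' = 2e^{t/2}h(t/2)` on `t < 0` is the multiple `h(0)·(1+t)e^{t}` of
the scaling mode.
[cite: Tao2016AveragedNS, §1.2 (dyadic model); cell vocabulary (linearisation of the scalar front equation of `DyadicScalarFronts` at the relay profile, drain dropped)] -/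
theorem pantograph_kernel {h : ℝ → ℝ} (hcont : ContinuousOn h (Iic 0))
    (hde : ∀ t : ℝ, t < 0 → HasDerivAt h (2 * Real.exp (t / 2) * h (t / 2)) t) :
    ∀ t : ℝ, t ≤ 0 → h t = h 0 * ((1 + t) * Real.exp t) := by
  set g : ℝ → ℝ := fun t => h t - h 0 * ((1 + t) * Real.exp t) with hg_def
  have hgcont : ContinuousOn g (Iic 0) :=
    hcont.sub (continuousOn_const.mul (by fun_prop))
  have hgde : ∀ t : ℝ, t < 0 → HasDerivAt g (2 * Real.exp (t / 2) * g (t / 2)) t := by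
    intro t ht
    have h1 := (relay_kernel_hasDerivAt t).const_mul (h 0)
    have h2 := (hde t ht).sub h1
    refine h2.congr_deriv ?_
    simp only [hg_def]
    ring
  have hg0 : g 0 = 0 := by simp [hg_def]
  intro t ht
  have := pantograph_eq_zero hgcont hgde hg0 t ht
  simp only [hg_def] at this
  linarith

/-- In particular a solution with `h(0) = 0` that is not identically zero does not exist: the only freedom
in the kernel is the value at `0⁻` (one real parameter). [folklore] -/
theorem pantograph_kernel_dim_one {h₁ h₂ : ℝ → ℝ} (hc₁ : ContinuousOn h₁ (Iic 0)) (hc₂ : ContinuousOn h₂ (Iic 0))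
    (hd₁ : ∀ t : ℝ, t < 0 → HasDerivAt h₁ (2 * Real.exp (t / 2) * h₁ (t / 2)) t)
    (hd₂ : ∀ t : ℝ, t < 0 → HasDerivAt h₂ (2 * Real.exp (t / 2) * h₂ (t / 2)) t)
    (h0 : h₁ 0 = h₂ 0) : ∀ t : ℝ, t ≤ 0 → h₁ t = h₂ t := by
  intro t ht
  rw [pantograph_kernel hc₁ hd₁ t ht, pantograph_kernel hc₂ hd₂ t ht, h0]

end WakeRatchetRelayKernel

end Summit.NavierStokesRegularity.NavierStokesRegularity.Theorems

end
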